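import Literature.Analysis.SpecialFunctions.JacobiThetaAGM
import HarnessLib

/-!
# The thetanull at `τ = i`: `λ(i) = ½`, `K(1/√2) = (π/2)ϑ₃(i)²`, and Gauss's value
# `ϑ₃(i) = π^{1/4}/Γ(3/4)` (equivalently `ϑ₃(i)² = Γ(¼)²/(2π√π)`)

Topic `Literature/Analysis/SpecialFunctions`; a worked instance (discriminant `−4`) of the bridge
`JacobiThetaAGM.lean` (Jacobi's inversion theorem `ellipticK (λ(iy)) = (π/2)ϑ₃(iy)²`) combined
with the tree's lemniscatic evaluation `K(1/√2) = Γ(¼)²/(4√π)` (Lawden (4.3.6), PROVED in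
`LemniscaticEllipticValuesProofs.lean`, `Lawden1989_eq_4_3_6_holds`). Everything is PROVED; no
definition and no named fact is introduced:

* `lamR_one : λ(i) = ½` (from `λ(i/t) = 1 − λ(it)` at `t = 1`);
* `ellipticK_one_half_eq : ellipticK (1/2) = (π/2)·ϑ₃(i)²` and
  `ellipticK_one_half_eq_lemniscaticK : ellipticK (1/2) = K(1/√2)` (`lemniscaticK`);
* `theta3_I_re_sq : ϑ₃(i)² = Γ(¼)²/(2π√π)`, `theta3_I_re_pow_four : ϑ₃(i)⁴ = Γ(¼)⁴/(4π³)`, and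
  `theta3_I_re_eq : ϑ₃(i) = Σₙ e^{−πn²} = π^{1/4}/Γ(¾)` (reflection `Γ(¼)Γ(¾) = π√2`) — the
  Chowla–Selberg value for `ℚ(i)` in theta form, the `D = −4` analogue of the theta form of
  `Literature.Analysis.FunctionSpaces.BorweinStraubWanZudilin2012_eq_5_3` (`D = −15`,
  `UniformRandomWalkDensityTheta.lean`).

## References

* D. F. Lawden, *Elliptic Functions and Applications* (1989), §2.2 eq. (2.2.3) (`K = ½πϑ₃²`),
  §4.3 eq. (4.3.6) (`K(1/√2) = ¼π^{−1/2}Γ(¼)²`). [Lawden1989]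
* E. T. Whittaker, G. N. Watson, *A Course of Modern Analysis*, 4th ed., §22.3 (`K = ½πϑ₃²`),
  §22.8 (`K₀ = ¼π^{−½}{Γ(¼)}²`, "`q₀ = e^{−π}`"; held copy PDF pp. 522, 546). [WhittakerWatson1927]
-/

noncomputable section

open Complex Real
open scoped Real

namespace Literature.Analysis.SpecialFunctions

open Literature.NumberTheory.EllipticCurves.JacobiThetaNull
open Literature.Probability.RandomPlanarGeometry
open Literature.Probability.RandomPlanarGeometry.KlebanZagier

/-- **`λ(i) = ½`**: the elliptic modulus at the square lattice is the lemniscatic one,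
`k² = ½`. [cite: KlebanZagier2003, §3] -/
theorem lamR_one : lamR 1 = 1 / 2 := by
  have h := lamR_inv one_pos
  rw [inv_one] at h
  linarith

/-- **`K(1/√2) = (π/2)ϑ₃(i)²`** in parameter form: `ellipticK (1/2) = (π/2)·ϑ₃(i)²`
(Jacobi's inversion theorem at `y = 1`). [cite: Lawden1989, §2.2 eq. (2.2.3)] -/
theorem ellipticK_one_half_eq : ellipticK (1 / 2) = π / 2 * (theta3 I).re ^ 2 := by
  have h := ellipticK_lamR one_pos
  rw [lamR_one] at h
  simpa using h

/-- `ellipticK (1/2)` is the lemniscatic integral `K(1/√2) = ∫₀¹ dt/√((1−t²)(1−t²/2))`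
(`lemniscaticK`). [cite: Lawden1989, §3.1 eq. (3.1.3)] -/
theorem ellipticK_one_half_eq_lemniscaticK : ellipticK (1 / 2) = lemniscaticK := by
  have h1 : completeEllipticK (1 / Real.sqrt 2) = ellipticK (1 / 2) := by
    rw [completeEllipticK_eq_ellipticK, div_pow, one_pow, Real.sq_sqrt (by norm_num : (0:ℝ) ≤ 2)]
  rw [← h1, completeEllipticK_inv_sqrt_two]
  rfl

/-- **`ϑ₃(i)² = Γ(¼)²/(2π√π)`** (from `K(1/√2) = Γ(¼)²/(4√π)`, Lawden (4.3.6), and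
`K = ½πϑ₃²`). [cite: Lawden1989, §4.3 eq. (4.3.6) with §2.2 eq. (2.2.3)] -/
theorem theta3_I_re_sq :
    (theta3 I).re ^ 2 = Real.Gamma (1 / 4) ^ 2 / (2 * π * Real.sqrt π) := by
  have h := Lawden1989_eq_4_3_6_holds
  unfold Lawden1989_eq_4_3_6 at h
  rw [← ellipticK_one_half_eq_lemniscaticK, ellipticK_one_half_eq] at h
  have hπ := Real.pi_pos
  have hs : 0 < Real.sqrt π := Real.sqrt_pos.mpr hπ
  field_simp at h
  field_simp
  linarith

/-- **`ϑ₃(i)⁴ = Γ(¼)⁴/(4π³)`.** [cite: Lawden1989, §4.3 eq. (4.3.6) with §2.2 eq. (2.2.3)] -/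
theorem theta3_I_re_pow_four : (theta3 I).re ^ 4 = Real.Gamma (1 / 4) ^ 4 / (4 * π ^ 3) := by
  have hπ := Real.pi_pos
  have hs : Real.sqrt π ^ 2 = π := Real.sq_sqrt hπ.le
  rw [show (theta3 I).re ^ 4 = ((theta3 I).re ^ 2) ^ 2 by ring, theta3_I_re_sq, div_pow, mul_pow,
    mul_pow, hs]
  ring

/-- **Gauss's value `ϑ₃(i) = Σₙ e^{−πn²} = π^{1/4}/Γ(¾)`** (the Chowla–Selberg value for `ℚ(i)` in
theta form; `Γ(¼)Γ(¾) = π√2`). [cite: Lawden1989, §4.3 eq. (4.3.6) with §2.2 eq. (2.2.3)] -/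
theorem theta3_I_re_eq : (theta3 I).re = π ^ (1 / 4 : ℝ) / Real.Gamma (3 / 4) := by
  have hπ := Real.pi_pos
  have hT : 0 < (theta3 I).re := by simpa using theta3_I_mul_re_pos one_pos
  have hG3 : 0 < Real.Gamma (3 / 4) := Real.Gamma_pos_of_pos (by norm_num)
  have hG1 : 0 < Real.Gamma (1 / 4) := Real.Gamma_pos_of_pos (by norm_num)
  -- reflection: `Γ(¼)Γ(¾) = π/sin(π/4) = π√2`
  have hrefl : Real.Gamma (1 / 4) * Real.Gamma (3 / 4) = π * Real.sqrt 2 := by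
    have h := Real.Gamma_mul_Gamma_one_sub (1 / 4 : ℝ)
    rw [show (1:ℝ) - 1 / 4 = 3 / 4 by norm_num, show π * (1 / 4 : ℝ) = π / 4 by ring,
      Real.sin_pi_div_four] at h
    rw [h]
    have h2 : Real.sqrt 2 ≠ 0 := (Real.sqrt_pos.mpr two_pos).ne'
    field_simp
    rw [Real.sq_sqrt (by norm_num : (0:ℝ) ≤ 2)]
  -- compare squares of the two positive numbers
  have hq : 0 < π ^ (1 / 4 : ℝ) / Real.Gamma (3 / 4) := div_pos (Real.rpow_pos_of_pos hπ _) hG3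
  refine (pow_left_inj₀ hT.le hq.le two_ne_zero).1 ?_
  have h4 : (π ^ (1 / 4 : ℝ)) ^ 2 = Real.sqrt π := by
    rw [← Real.rpow_natCast, ← Real.rpow_mul hπ.le, Real.sqrt_eq_rpow]
    norm_num
  rw [theta3_I_re_sq, div_pow, h4]
  -- `Γ(¼)²/(2π√π) = √π/Γ(¾)²`
  have hs2 : Real.sqrt 2 ^ 2 = 2 := Real.sq_sqrt (by norm_num)
  have hsπ : Real.sqrt π ^ 2 = π := Real.sq_sqrt hπ.le
  have hsπ0 : 0 < Real.sqrt π := Real.sqrt_pos.mpr hπ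
  rw [div_eq_div_iff (by positivity) (by positivity)]
  have e : Real.Gamma (1 / 4) = π * Real.sqrt 2 / Real.Gamma (3 / 4) := by
    rw [eq_div_iff hG3.ne', hrefl]
  rw [e]
  field_simp
  nlinarith [hs2, hsπ, hπ]

end Literature.Analysis.SpecialFunctions
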